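import Literature.Computability.Complexity.CertificateAlgorithm
import HarnessLib

/-!
# Nisan's randomized lower bound `bs(f) ≤ 3 R₂(f)` and `D(f) ≤ 27 R₂(f)³`

Reproduction (trunk `Literature/Computability/Complexity`; solo seat
`solo-QuantumAdvantage-informed`, session 3) of

* N. Nisan, *CREW PRAMs and decision trees*, SIAM J. Comput. 20 (1991) 999–1007: bounded-error
  randomized decision trees need `Ω(bs(f))` queries;
* as stated and proved in H. Buhrman, R. de Wolf, *Complexity measures and decision tree
  complexity: a survey*, Theoret. Comput. Sci. 288 (2002) 21–43, **Theorem 16** (Nisan)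
  `bs(f) ≤ 3 R₂(f)` and **Corollary 3** (Nisan) `D(f) ≤ 27 R₂(f)³`
  [galaxy: pdf:-6514774275231728200 p.14 (CWI preprint of the survey, Dec. 1999)].

What is reproduced, over the tree's decision-tree model (`DecisionTree`, `randQueryComplexity`,
`blockSensitivity`, `detQueryComplexity_le_blockSensitivity_pow_three`):

* `DecisionTree.exists_path_finset`: a tree of depth `d` reads, on input `x`, a set `S` of at most
  `d` positions, and flipping any block disjoint from `S` does not change the answer;
* `DecisionTree.card_filter_flip_ne_le_depth`: hence among pairwise disjoint blocks at most
  `depth T` can change `T`'s answer on `x`;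
* `PMF.sum_toOuterMeasure_flip_ne_le`: for a distribution `μ` over trees of depth `≤ d`, the
  probabilities that block `B` changes the answer, summed over a disjoint family, total `≤ d`
  (expected number of blocks read `≤` expected number of queries `≤ d`);
* `PMF.ofReal_le_toOuterMeasure_flip_ne`: if `μ` computes `f` with error `ε` on `x` and on `x^B`
  and `B` is sensitive, then `B` changes the answer with probability `≥ 1 - 2ε` ("otherwise the
  algorithm could not see the difference between `x` and `x^B`");
* `blockSensitivity_mul_le_randQueryComplexity : (1 - 2ε)·bs(f) ≤ R_ε(f)` (`0 ≤ ε`), whence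
  **`blockSensitivity_le_three_mul_randQueryComplexity : bs(f) ≤ 3 R₂(f)`** (Thm 16) and
  **`detQueryComplexity_le_27_mul_randQueryComplexity_pow_three : D(f) ≤ 27 R₂(f)³`** (Cor 3).

Consumer: `Summits/QuantumAdvantage/QuantumAdvantage/Theorems/SoloInformedPsdCounting*` (classical
pseudo-deterministic lower bounds for approximate majority, after Goldreich–Goldwasser–Ron 2013).

## References
* [Nisan1991] N. Nisan, *CREW PRAMs and decision trees*, SIAM J. Comput. 20(6) (1991) 999–1007.
* [Wolf2002] H. Buhrman, R. de Wolf, *Complexity measures and decision tree complexity: a survey*,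
  TCS 288 (2002) 21–43, Thm 16, Cor 3 (preprint p. 14).
-/

noncomputable section

namespace Literature.Computability.Complexity

open Finset
open scoped ENNReal

variable {N : ℕ}

/-! ### What a tree reads -/

/-- **A tree reads at most `depth` positions.** For every tree `T` and input `x` there is a set
`S` of at most `depth T` positions such that flipping any block disjoint from `S` leaves the
answer unchanged (the positions queried along `x`'s path). [cite: Wolf2002, §2.1] -/
theorem DecisionTree.exists_path_finset (T : DecisionTree N) (x : Fin N → Bool) :
    ∃ S : Finset (Fin N), S.card ≤ T.depth ∧
      ∀ B : Finset (Fin N), Disjoint B S → T.eval (flipBlock x B) = T.eval x := by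
  classical
  induction T with
  | leaf b => exact ⟨∅, by simp, fun B _ => rfl⟩
  | query i t₀ t₁ ih₀ ih₁ =>
    obtain ⟨S₀, hS₀, h₀⟩ := ih₀
    obtain ⟨S₁, hS₁, h₁⟩ := ih₁
    cases hxi : x i
    · refine ⟨insert i S₀, ?_, fun B hB => ?_⟩
      · have h1 := Finset.card_insert_le i S₀
        have h2 := le_max_left t₀.depth t₁.depth
        rw [DecisionTree.depth_query]
        omega
      · have hiB : i ∉ B := fun h => (Finset.disjoint_left.mp hB h) (Finset.mem_insert_self i S₀)
        have hyi : flipBlock x B i = false := by rw [flipBlock_apply_of_not_mem hiB, hxi]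
        simp only [DecisionTree.eval_query, hyi, hxi]
        exact h₀ B
          (hB.mono_right (Finset.subset_insert i S₀))
    · refine ⟨insert i S₁, ?_, fun B hB => ?_⟩
      · have h1 := Finset.card_insert_le i S₁
        have h2 := le_max_right t₀.depth t₁.depth
        rw [DecisionTree.depth_query]
        omega
      · have hiB : i ∉ B := fun h => (Finset.disjoint_left.mp hB h) (Finset.mem_insert_self i S₁)
        have hyi : flipBlock x B i = true := by rw [flipBlock_apply_of_not_mem hiB, hxi]
        simp only [DecisionTree.eval_query, hyi, hxi]
        exact h₁ B (hB.mono_right (Finset.subset_insert i S₁))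

/-- **At most `depth T` disjoint blocks can change the answer.** If the blocks of `𝓑` are
pairwise disjoint, the number of `B ∈ 𝓑` with `T(x^B) ≠ T(x)` is at most `depth T` (each such
block meets the `≤ depth T` positions read on `x`). [cite: Wolf2002, Thm 16 (proof)] -/
theorem DecisionTree.card_filter_flip_ne_le_depth (T : DecisionTree N) (x : Fin N → Bool)
    (𝓑 : Finset (Finset (Fin N))) (h𝓑 : (𝓑 : Set (Finset (Fin N))).PairwiseDisjoint id) :
    (𝓑.filter fun B => T.eval (flipBlock x B) ≠ T.eval x).card ≤ T.depth := by
  classical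
  obtain ⟨S, hS, hagree⟩ := T.exists_path_finset x
  set 𝓓 := 𝓑.filter fun B => T.eval (flipBlock x B) ≠ T.eval x with h𝓓
  have hmeet : ∀ B ∈ 𝓓, (B ∩ S).Nonempty := by
    intro B hB
    rw [h𝓓, Finset.mem_filter] at hB
    by_contra h
    rw [Finset.not_nonempty_iff_eq_empty] at h
    exact hB.2 (hagree B (Finset.disjoint_iff_inter_eq_empty.mpr h))
  have hdisj : (𝓓 : Set (Finset (Fin N))).PairwiseDisjoint fun B => B ∩ S := by
    intro B hB B' hB' hne
    have hB𝓑 : B ∈ 𝓑 := (Finset.mem_filter.mp hB).1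
    have hB'𝓑 : B' ∈ 𝓑 := (Finset.mem_filter.mp hB').1
    have hd : Disjoint B B' := h𝓑 hB𝓑 hB'𝓑 hne
    exact hd.mono Finset.inter_subset_left Finset.inter_subset_left
  calc 𝓓.card = ∑ B ∈ 𝓓, 1 := by simp
    _ ≤ ∑ B ∈ 𝓓, (B ∩ S).card :=
        Finset.sum_le_sum fun B hB => Finset.one_le_card.mpr (hmeet B hB)
    _ = (𝓓.biUnion fun B => B ∩ S).card := (Finset.card_biUnion hdisj).symm
    _ ≤ S.card :=
        Finset.card_le_card (Finset.biUnion_subset.mpr fun B _ => Finset.inter_subset_right)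
    _ ≤ T.depth := hS

/-! ### Expected number of blocks read -/

/-- **Expected blocks read `≤` depth.** For a distribution `μ` over trees of depth `≤ d` and a
pairwise disjoint family `𝓑`: `∑_{B ∈ 𝓑} Pr_μ[T(x^B) ≠ T(x)] ≤ d`.
[cite: Wolf2002, Thm 16 (proof: "the total expected number of queries on input x")] -/
theorem PMF.sum_toOuterMeasure_flip_ne_le (μ : PMF (DecisionTree N)) {d : ℕ}
    (hd : ∀ T ∈ μ.support, T.depth ≤ d) (x : Fin N → Bool) (𝓑 : Finset (Finset (Fin N)))
    (h𝓑 : (𝓑 : Set (Finset (Fin N))).PairwiseDisjoint id) :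
    ∑ B ∈ 𝓑, μ.toOuterMeasure {T | T.eval (flipBlock x B) ≠ T.eval x} ≤ d := by
  classical
  simp_rw [PMF.toOuterMeasure_apply]
  rw [← Summable.tsum_finsetSum (fun _ _ => ENNReal.summable)]
  calc ∑' T, ∑ B ∈ 𝓑,
        ({T : DecisionTree N | T.eval (flipBlock x B) ≠ T.eval x}).indicator (⇑μ) T
      ≤ ∑' T, μ T * d := ENNReal.tsum_le_tsum fun T => ?_
    _ = d := by rw [ENNReal.tsum_mul_right, PMF.tsum_coe, one_mul]
  have hsum : ∑ B ∈ 𝓑, ({T : DecisionTree N | T.eval (flipBlock x B) ≠ T.eval x}).indicator (⇑μ) T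
      = ((𝓑.filter fun B => T.eval (flipBlock x B) ≠ T.eval x).card : ℝ≥0∞) * μ T := by
    rw [← Finset.sum_filter_add_sum_filter_not 𝓑 (fun B => T.eval (flipBlock x B) ≠ T.eval x)]
    have h1 : ∑ B ∈ 𝓑.filter (fun B => T.eval (flipBlock x B) ≠ T.eval x),
        ({T : DecisionTree N | T.eval (flipBlock x B) ≠ T.eval x}).indicator (⇑μ) T
        = ∑ B ∈ 𝓑.filter (fun B => T.eval (flipBlock x B) ≠ T.eval x), μ T :=
      Finset.sum_congr rfl fun B hB => by
        rw [Set.indicator_of_mem]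
        exact (Finset.mem_filter.mp hB).2
    have h2 : ∑ B ∈ 𝓑.filter (fun B => ¬ T.eval (flipBlock x B) ≠ T.eval x),
        ({T : DecisionTree N | T.eval (flipBlock x B) ≠ T.eval x}).indicator (⇑μ) T = 0 :=
      Finset.sum_eq_zero fun B hB => by
        rw [Set.indicator_of_notMem]
        exact (Finset.mem_filter.mp hB).2
    rw [h1, h2, add_zero, Finset.sum_const, nsmul_eq_mul]
  rw [hsum]
  by_cases hT : T ∈ μ.support
  · calc ((𝓑.filter fun B => T.eval (flipBlock x B) ≠ T.eval x).card : ℝ≥0∞) * μ T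
        ≤ (T.depth : ℝ≥0∞) * μ T := by
          gcongr
          exact_mod_cast T.card_filter_flip_ne_le_depth x 𝓑 h𝓑
      _ ≤ (d : ℝ≥0∞) * μ T := by
          gcongr
          exact_mod_cast hd T hT
      _ = μ T * d := mul_comm _ _
  · have h0 : μ T = 0 := by
      rw [PMF.mem_support_iff, not_not] at hT
      exact hT
    simp [h0]

/-! ### A sensitive block must be read with probability `≥ 1 - 2ε` -/

/-- **Inclusion–exclusion for a PMF's outer measure**: `Pr[A] + Pr[A'] ≤ 1 + Pr[A ∩ A']`.
[folklore] -/
theorem PMF.toOuterMeasure_add_le_one_add_inter {α : Type*} (μ : PMF α) (A A' : Set α) :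
    μ.toOuterMeasure A + μ.toOuterMeasure A' ≤ 1 + μ.toOuterMeasure (A ∩ A') := by
  classical
  rw [PMF.toOuterMeasure_apply, PMF.toOuterMeasure_apply, PMF.toOuterMeasure_apply,
    ← ENNReal.tsum_add, ← μ.tsum_coe, ← ENNReal.tsum_add]
  refine ENNReal.tsum_le_tsum fun a => ?_
  by_cases hA : a ∈ A <;> by_cases hA' : a ∈ A' <;>
    simp [hA, hA', Set.mem_inter_iff]

/-- **Nisan's observation.** If `μ` answers `f` correctly with probability `≥ 1 - ε` on `x` and
on `x^B`, and `f(x^B) ≠ f(x)`, then `Pr_μ[T(x^B) ≠ T(x)] ≥ 1 - 2ε` ("otherwise the algorithm could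
not see the difference between `x` and `x^B` with sufficient probability").
[cite: Wolf2002, Thm 16 (proof)] -/
theorem PMF.ofReal_le_toOuterMeasure_flip_ne (μ : PMF (DecisionTree N)) {ε : ℝ}
    {f : (Fin N → Bool) → Bool} {x : Fin N → Bool} {B : Finset (Fin N)}
    (hx : 1 - ε ≤ (μ.toOuterMeasure {T | T.eval x = f x}).toReal)
    (hxB : 1 - ε ≤ (μ.toOuterMeasure {T | T.eval (flipBlock x B) = f (flipBlock x B)}).toReal)
    (hB : IsSensitiveBlock f x B) :
    ENNReal.ofReal (1 - 2 * ε) ≤ μ.toOuterMeasure {T | T.eval (flipBlock x B) ≠ T.eval x} := by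
  set A : Set (DecisionTree N) := {T | T.eval x = f x} with hA
  set A' : Set (DecisionTree N) := {T | T.eval (flipBlock x B) = f (flipBlock x B)} with hA'
  set Dif : Set (DecisionTree N) := {T | T.eval (flipBlock x B) ≠ T.eval x} with hDif
  have hsub : A ∩ A' ⊆ Dif := by
    rintro T ⟨h1, h2⟩
    simp only [hA, hA', hDif, Set.mem_setOf_eq] at h1 h2 ⊢
    rw [h1, h2]
    exact hB
  have hmono : μ.toOuterMeasure (A ∩ A') ≤ μ.toOuterMeasure Dif := μ.toOuterMeasure.mono hsub
  have h1 : ENNReal.ofReal (1 - ε) ≤ μ.toOuterMeasure A := ENNReal.ofReal_le_of_le_toReal hx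
  have h2 : ENNReal.ofReal (1 - ε) ≤ μ.toOuterMeasure A' := ENNReal.ofReal_le_of_le_toReal hxB
  have key : ENNReal.ofReal (1 - ε) + ENNReal.ofReal (1 - ε) ≤ 1 + μ.toOuterMeasure Dif :=
    (add_le_add h1 h2).trans
      ((PMF.toOuterMeasure_add_le_one_add_inter μ A A').trans (by gcongr))
  by_cases hε2 : 1 - 2 * ε ≤ 0
  · rw [ENNReal.ofReal_of_nonpos hε2]
    simp
  · rw [not_le] at hε2
    have heq : ENNReal.ofReal (1 - ε) + ENNReal.ofReal (1 - ε) = 1 + ENNReal.ofReal (1 - 2 * ε) := by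
      rw [← ENNReal.ofReal_one, ← ENNReal.ofReal_add (by linarith) (by linarith),
        ← ENNReal.ofReal_add (by norm_num) (by linarith)]
      congr 1
      ring
    rw [heq] at key
    exact (ENNReal.add_le_add_iff_left ENNReal.one_ne_top).mp key

/-! ### Nisan's theorem -/

/-- The defining set of `randQueryComplexity ε f` is nonempty for `0 ≤ ε` (a deterministic tree
for `f` as a point mass). [cite: Wolf2002, §2.2] -/
theorem randQueryComplexity_set_nonempty {ε : ℝ} (hε : 0 ≤ ε) (f : (Fin N → Bool) → Bool) :
    {d | ∃ μ : PMF (DecisionTree N), (∀ T ∈ μ.support, T.depth ≤ d) ∧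
      ∀ x, 1 - ε ≤ (μ.toOuterMeasure {T | T.eval x = f x}).toReal}.Nonempty := by
  classical
  obtain ⟨T, hT, -⟩ := DecisionTree.exists_computes_depth_le f
  refine ⟨T.depth, PMF.pure T, fun T' hT' => ?_, fun x => ?_⟩
  · rw [PMF.support_pure, Set.mem_singleton_iff] at hT'
    rw [hT']
  · have h1 : (PMF.pure T).toOuterMeasure {T' : DecisionTree N | T'.eval x = f x} = 1 := by
      rw [PMF.toOuterMeasure_pure_apply, if_pos]
      exact hT x
    rw [h1, ENNReal.toReal_one]
    linarith

/-- `R_ε(f)` is attained by some distribution (`0 ≤ ε`). [cite: Wolf2002, §2.2] -/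
theorem exists_pmf_randQueryComplexity {ε : ℝ} (hε : 0 ≤ ε) (f : (Fin N → Bool) → Bool) :
    ∃ μ : PMF (DecisionTree N), (∀ T ∈ μ.support, T.depth ≤ randQueryComplexity ε f) ∧
      ∀ x, 1 - ε ≤ (μ.toOuterMeasure {T | T.eval x = f x}).toReal :=
  Nat.sInf_mem (randQueryComplexity_set_nonempty hε f)

/-- `bs(f)` is attained: some input carries a disjoint sensitive family of `bs(f)` blocks.
[cite: BealsEtAl2001, Def 4.11] -/
theorem exists_family_card_eq_blockSensitivity (f : (Fin N → Bool) → Bool) :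
    ∃ (x : Fin N → Bool) (𝓑 : Finset (Finset (Fin N))),
      IsSensitiveFamily f x 𝓑 ∧ 𝓑.card = blockSensitivity f := by
  classical
  obtain ⟨x, -, hx⟩ := Finset.exists_mem_eq_sup (Finset.univ : Finset (Fin N → Bool))
    Finset.univ_nonempty (blockSensitivityAt f)
  obtain ⟨𝓑, h𝓑, hcard⟩ := exists_family_card_eq f x
  refine ⟨x, 𝓑, h𝓑, ?_⟩
  rw [hcard]
  exact hx.symm

/-- **Nisan 1991, general error** (Buhrman–de Wolf Thm 16, proof): `(1 - 2ε) · bs(f) ≤ R_ε(f)`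
for `0 ≤ ε`: on the input achieving `bs(f)`, each of the `bs(f)` disjoint sensitive blocks is read
with probability `≥ 1 - 2ε`, and the expected number of blocks read is at most the depth.
[cite: Nisan1991] [cite: Wolf2002, Thm 16] -/
theorem blockSensitivity_mul_le_randQueryComplexity {ε : ℝ} (hε : 0 ≤ ε)
    (f : (Fin N → Bool) → Bool) :
    (1 - 2 * ε) * (blockSensitivity f : ℝ) ≤ randQueryComplexity ε f := by
  classical
  obtain ⟨μ, hd, hμ⟩ := exists_pmf_randQueryComplexity hε f
  obtain ⟨x, 𝓑, h𝓑, hbs⟩ := exists_family_card_eq_blockSensitivity f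
  have hlow : ∑ B ∈ 𝓑, ENNReal.ofReal (1 - 2 * ε) ≤
      ∑ B ∈ 𝓑, μ.toOuterMeasure {T | T.eval (flipBlock x B) ≠ T.eval x} :=
    Finset.sum_le_sum fun B hB =>
      PMF.ofReal_le_toOuterMeasure_flip_ne μ (hμ x) (hμ (flipBlock x B)) (h𝓑.1 B hB)
  have hup := PMF.sum_toOuterMeasure_flip_ne_le μ hd x 𝓑 h𝓑.2
  rw [Finset.sum_const, nsmul_eq_mul] at hlow
  have h : (𝓑.card : ℝ≥0∞) * ENNReal.ofReal (1 - 2 * ε) ≤ (randQueryComplexity ε f : ℝ≥0∞) :=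
    hlow.trans hup
  by_cases hε2 : 1 - 2 * ε ≤ 0
  · have hb : (0 : ℝ) ≤ blockSensitivity f := Nat.cast_nonneg _
    have hR : (0 : ℝ) ≤ randQueryComplexity ε f := Nat.cast_nonneg _
    nlinarith
  · rw [not_le] at hε2
    have h' := ENNReal.toReal_mono (ENNReal.natCast_ne_top _) h
    rw [ENNReal.toReal_mul, ENNReal.toReal_natCast, ENNReal.toReal_natCast,
      ENNReal.toReal_ofReal hε2.le, mul_comm] at h'
    rw [← hbs]
    exact h'

/-- **Nisan 1991 / Buhrman–de Wolf Theorem 16: `bs(f) ≤ 3 R₂(f)`.** [cite: Nisan1991]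
[cite: Wolf2002, Thm 16] -/
theorem blockSensitivity_le_three_mul_randQueryComplexity (f : (Fin N → Bool) → Bool) :
    blockSensitivity f ≤ 3 * randQueryComplexity (1 / 3) f := by
  have h := blockSensitivity_mul_le_randQueryComplexity (by norm_num : (0 : ℝ) ≤ 1 / 3) f
  have h' : (blockSensitivity f : ℝ) ≤ 3 * randQueryComplexity (1 / 3) f := by linarith
  exact_mod_cast h'

/-- **Nisan 1991 / Buhrman–de Wolf Corollary 3: `D(f) ≤ 27 R₂(f)³`** — deterministic and
bounded-error randomized query complexity of TOTAL Boolean functions are polynomially (cubically)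
related (`D ≤ bs³ ≤ (3R₂)³`). [cite: Nisan1991] [cite: Wolf2002, Cor 3] -/
theorem detQueryComplexity_le_27_mul_randQueryComplexity_pow_three (f : (Fin N → Bool) → Bool) :
    detQueryComplexity f ≤ 27 * randQueryComplexity (1 / 3) f ^ 3 :=
  calc detQueryComplexity f ≤ blockSensitivity f ^ 3 :=
        detQueryComplexity_le_blockSensitivity_pow_three f
    _ ≤ (3 * randQueryComplexity (1 / 3) f) ^ 3 :=
        Nat.pow_le_pow_left (blockSensitivity_le_three_mul_randQueryComplexity f) 3
    _ = 27 * randQueryComplexity (1 / 3) f ^ 3 := by ring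

end Literature.Computability.Complexity

end
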